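import Summits.AtomisticToContinuum.Crystallization.Theorems.ChartedZeroExcessLayeredLatticeLiouvilleTS

/-!
# Zero-excess layered lattice Liouville — part TU (lens-2 g42 node «MeanRotationIdentification»): the piece K_ID of (K), PROVED

Critic row 697 (d): «K_ID (mean-rotation identification from the registration's position budget — the Poincaré step) is the next PROVABLE
discrete piece».  This file proves it — and shows that NEITHER the position budget NOR a Poincaré inequality is needed: the GRADIENT budget of the
registration and an AVERAGE over the window suffice, because the mean rotation is ONE object.

* XXI.3 ★ POINTWISE IDENTIFICATION AGAINST THE IDENTITY (`tilt_le_of_fit_id_of_good`, `tilt_le_of_registered_of_doorP`): registration consistency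
  (`IsRegistered`, clause (i): `dist (p − x) (Ψ p − Ψ x) ≤ τ x` on `4`-bonds) says that the IDENTITY map fits the displacements at `x` up to `τ x`; part
  TS's identification lemma (`norm_linear_sub_rot_le_of_good` with `G := 1`) then gives `tilt (Q x) = ‖Q x − 1‖ ≤ 3·(τ x + σ x)` at every clean window
  site whose frame atoms lie in the registered window.  (On its own this only yields `Σ tilt³ ≲ Σ τ³ + Σ σ³ = O(η)·nK` — the Chebyshev loss of critic
  row 581; the gain is in the next step.)
* XXI.2/4 ★★ THE MEAN-ROTATION IDENTIFICATION (`nK_mul_pow_three_le_of_pointwise`, `meanRotation_identification`): for ANY continuous linear map `Q̄`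
  and any finite set `I` of such sites, averaging `‖Q̄ − 1‖ ≤ ‖Q x − Q̄‖ + 3τ x + 3σ x` over `I` and using the power-mean / Cauchy–Schwarz inequalities,
  `nK I · ‖Q̄ − 1‖³ ≤ 16·Σ_I ‖Q x − Q̄‖³ + 432·Σ_I σ³ + 108·ζ³·nK I` whenever `Σ_I τ² ≤ ζ²·nK I`.
  With the registration's gradient level `ζ² ≍ Cg·η` the identification remainder is `≍ (Cg·η)^{3/2}` PER SITE — `o(η)`, exactly the `ε·η·nK` slack
  of (K) `TiltRigidityP`.  The exponent gain `η ↦ η^{3/2}` comes from averaging BEFORE cubing (Jensen: `(avg τ)² ≤ avg τ²`),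
  not from positions.
* XXI.5 the TILT SPLIT `Σ_W tilt³ ≤ 4·Σ_W ‖Q x − Q̄‖³ + 4·nK W·‖Q̄ − 1‖³` and the product form `nK_mul_finsum_tilt_pow_three_le` ready for the (K) seam.
After parts TS + TU, (K) ⟸ (K_F) FIELD RIGIDITY `∃ Q̄, Σ_{win R} ‖Q x − Q̄‖³ ≤ C_F·Σ σ³` (the interpolation bookkeeping + Friesecke–James–Müller in `L³`,
to be typed by g43 as the discrete statement consumed, critic row 697 (b)) ∧ (K_dens) a window density ratio `nK (win R) ≤ K_d·nK (win (R − 3aHi/2))`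
for `R ≥ R₁(aHi, δ)` (packing + the tree's `5`-relative density of clean sets, `exists_mem_dist_lt_five_of_cleanP`) ∧ arithmetic
(`108·(K_d·Cg·η)^{3/2} ≤ ε·η` for `η ≤ η₁(ε) := (ε/(108·(K_d·Cg)^{3/2}))²`).  ENERGY-FREE; no chart, no `IsEquilChart`, no θ; constants
absolute (`3, 16, 432, 108, 4`).  0 new `Prop`, 0 EQUIV; placeholder-free; no type-class declarations, custom syntax or option pragmas.
-/

noncomputable section

open scoped BigOperators InnerProductSpace
open MeasureTheory Set Metric Filter Topology
open Summit.AtomisticToContinuum.Crystallization.Theorems.ChartedPlanarOrderRigidityDoor (E3 atomsIn)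
open Summit.AtomisticToContinuum.Crystallization.Theorems.ChartedPlanarOrderDensityDichotomy (μS IsSep nK nK_nonneg)
open Summit.AtomisticToContinuum.Crystallization.Theorems.ChartedPlanarOrderCleanScaleP (IsDoorSetP isCleanP_μS_iff)
open Literature.Geometry.DiscreteGeometry (IsTwoShellGoodSet)

namespace Summit.AtomisticToContinuum.Crystallization.Theorems.ChartedZeroExcessLayeredLatticeLiouville

/-! ### XXI.1  Two elementary cube inequalities -/

/-- `(x + y)³ ≤ 4·(x³ + y³)` for `x, y ≥ 0` (the difference is `3(x + y)(x − y)²`). [folklore] -/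
private theorem add_pow_three_le_four_mul {x y : ℝ} (hx : 0 ≤ x) (hy : 0 ≤ y) : (x + y) ^ 3 ≤ 4 * (x ^ 3 + y ^ 3) := by
  nlinarith [mul_nonneg (add_nonneg hx hy) (sq_nonneg (x - y))]

/-- power mean of order three on a finset: `(Σ_s b)³ ≤ (#s)²·Σ_s b³` for `b ≥ 0`. [folklore] -/
theorem sum_pow_three_le_card_sq_mul_sum (s : Finset E3) {b : E3 → ℝ} (hb : ∀ x ∈ s, 0 ≤ b x) :
    (∑ x ∈ s, b x) ^ 3 ≤ (s.card : ℝ) ^ 2 * ∑ x ∈ s, b x ^ 3 := by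
  rcases s.eq_empty_or_nonempty with rfl | hne
  · simp
  have hm : (0 : ℝ) < s.card := by exact_mod_cast hne.card_pos
  set m : ℝ := (s.card : ℝ) with hmdef
  have hw : ∑ x ∈ s, (fun _ : E3 => m⁻¹) x = 1 := by
    rw [Finset.sum_const, nsmul_eq_mul, ← hmdef]
    exact mul_inv_cancel₀ hm.ne'
  have hpm := Real.pow_arith_mean_le_arith_mean_pow s (fun _ => m⁻¹) b (fun _ _ => inv_nonneg.2 hm.le) hw hb 3
  rw [← Finset.mul_sum, ← Finset.mul_sum, mul_pow] at hpm
  -- `m⁻¹³·B³ ≤ m⁻¹·Σ b³`; multiply by `m³`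
  have h3 : m ^ 3 * ((m⁻¹) ^ 3 * (∑ x ∈ s, b x) ^ 3) ≤ m ^ 3 * (m⁻¹ * ∑ x ∈ s, b x ^ 3) :=
    mul_le_mul_of_nonneg_left hpm (pow_nonneg hm.le 3)
  have e1 : m ^ 3 * ((m⁻¹) ^ 3 * (∑ x ∈ s, b x) ^ 3) = (∑ x ∈ s, b x) ^ 3 := by
    rw [← mul_assoc, ← mul_pow, mul_inv_cancel₀ hm.ne', one_pow, one_mul]
  have e2 : m ^ 3 * (m⁻¹ * ∑ x ∈ s, b x ^ 3) = m ^ 2 * ∑ x ∈ s, b x ^ 3 := by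
    rw [← mul_assoc, pow_succ, mul_assoc (m ^ 2), mul_inv_cancel₀ hm.ne', mul_one]
  rwa [e1, e2] at h3

/-- Cauchy–Schwarz on a finset in mean-square form: `Σ_s τ² ≤ ζ²·#s` with `ζ ≥ 0` gives `Σ_s τ ≤ ζ·#s`. [folklore] -/
theorem sum_le_mul_card_of_sum_sq_le (s : Finset E3) {τ : E3 → ℝ} {ζ : ℝ} (hζ : 0 ≤ ζ) (hτ : ∑ x ∈ s, τ x ^ 2 ≤ ζ ^ 2 * s.card) :
    ∑ x ∈ s, τ x ≤ ζ * s.card := by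
  have hcs := Finset.sum_mul_sq_le_sq_mul_sq s (fun _ => (1 : ℝ)) τ
  simp only [one_mul, one_pow, Finset.sum_const, nsmul_eq_mul, mul_one] at hcs
  have hm : (0 : ℝ) ≤ s.card := Nat.cast_nonneg _
  have h2 : (∑ x ∈ s, τ x) ^ 2 ≤ (ζ * s.card) ^ 2 :=
    hcs.trans (by rw [mul_pow]; nlinarith [mul_le_mul_of_nonneg_left hτ hm])
  exact abs_le_of_sq_le_sq' h2 (mul_nonneg hζ hm) |>.2

/-! ### XXI.2  The averaging lemma (finset and window forms) -/

/-- ★★ **averaging a pointwise identification** (finset form): if `0 ≤ t ≤ a x + 3·(τ x + σ x)` at every point of `s` (`a, σ, τ ≥ 0`) and the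
mean square of `τ` on `s` is `≤ ζ²`, then `#s · t³ ≤ 16·Σ a³ + 432·Σ σ³ + 108·ζ³·#s`.  (`#s·t ≤ Σ(a + 3σ) + 3Στ`, `Στ ≤ ζ·#s` by Cauchy–Schwarz,
`(Σ b)³ ≤ (#s)²·Σ b³` by the power mean, `(u + v)³ ≤ 4(u³ + v³)` twice.) [this file, g42] -/
theorem card_mul_pow_three_le_of_pointwise (s : Finset E3) {t ζ : ℝ} (ht : 0 ≤ t) (hζ : 0 ≤ ζ) {a σ τ : E3 → ℝ}
    (ha : ∀ x ∈ s, 0 ≤ a x) (hσ : ∀ x ∈ s, 0 ≤ σ x) (hτ0 : ∀ x ∈ s, 0 ≤ τ x)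
    (hpt : ∀ x ∈ s, t ≤ a x + 3 * (τ x + σ x)) (hτ : ∑ x ∈ s, τ x ^ 2 ≤ ζ ^ 2 * s.card) :
    (s.card : ℝ) * t ^ 3 ≤ 16 * ∑ x ∈ s, a x ^ 3 + 432 * ∑ x ∈ s, σ x ^ 3 + 108 * ζ ^ 3 * s.card := by
  rcases s.eq_empty_or_nonempty with rfl | hne
  · simp
  have hm : (0 : ℝ) < s.card := by exact_mod_cast hne.card_pos
  set m : ℝ := (s.card : ℝ) with hmdef
  set B : ℝ := ∑ x ∈ s, (a x + 3 * σ x) with hBdef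
  set C : ℝ := ∑ x ∈ s, τ x with hCdef
  have hb0 : ∀ x ∈ s, 0 ≤ a x + 3 * σ x := fun x hx => by linarith [ha x hx, hσ x hx]
  have hB0 : 0 ≤ B := Finset.sum_nonneg hb0
  have hC0 : 0 ≤ C := Finset.sum_nonneg hτ0
  -- step 1: `m·t ≤ B + 3C`
  have h1 : m * t ≤ B + 3 * C := by
    have h := Finset.card_nsmul_le_sum s (fun x => a x + 3 * (τ x + σ x)) t hpt
    rw [nsmul_eq_mul, ← hmdef] at h
    have e : ∑ x ∈ s, (a x + 3 * (τ x + σ x)) = B + 3 * C := by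
      rw [hBdef, hCdef, Finset.mul_sum, ← Finset.sum_add_distrib]
      exact Finset.sum_congr rfl fun x _ => by ring
    linarith
  -- step 2: `C ≤ ζ·m` (Cauchy–Schwarz)
  have h2 : C ≤ ζ * m := sum_le_mul_card_of_sum_sq_le s hζ hτ
  -- step 3: `B³ ≤ m²·Σ b³` (power mean) and `b³ ≤ 4(a³ + 27σ³)`
  have h3 : B ^ 3 ≤ m ^ 2 * ∑ x ∈ s, (a x + 3 * σ x) ^ 3 := sum_pow_three_le_card_sq_mul_sum s hb0
  have h4 : ∑ x ∈ s, (a x + 3 * σ x) ^ 3 ≤ 4 * ∑ x ∈ s, a x ^ 3 + 108 * ∑ x ∈ s, σ x ^ 3 := by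
    have h := Finset.sum_le_sum fun x hx =>
      add_pow_three_le_four_mul (ha x hx) (by linarith [hσ x hx] : (0 : ℝ) ≤ 3 * σ x)
    refine h.trans (le_of_eq ?_)
    rw [Finset.mul_sum, Finset.mul_sum, ← Finset.sum_add_distrib]
    exact Finset.sum_congr rfl fun x _ => by ring
  -- step 4: combine: `(m t)³ ≤ (B + 3ζm)³ ≤ 4(B³ + 27ζ³m³)`
  have h5 : m * t ≤ B + 3 * (ζ * m) := by linarith
  have h6 : (m * t) ^ 3 ≤ (B + 3 * (ζ * m)) ^ 3 := pow_le_pow_left₀ (mul_nonneg hm.le ht) h5 3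
  have h7 : (B + 3 * (ζ * m)) ^ 3 ≤ 4 * (B ^ 3 + (3 * (ζ * m)) ^ 3) :=
    add_pow_three_le_four_mul hB0 (by positivity)
  have hS0 : 0 ≤ ∑ x ∈ s, σ x ^ 3 := Finset.sum_nonneg fun x hx => pow_nonneg (hσ x hx) 3
  have hA0 : 0 ≤ ∑ x ∈ s, a x ^ 3 := Finset.sum_nonneg fun x hx => pow_nonneg (ha x hx) 3
  have key : m ^ 2 * (m * t ^ 3) ≤ m ^ 2 * (16 * ∑ x ∈ s, a x ^ 3 + 432 * ∑ x ∈ s, σ x ^ 3 + 108 * ζ ^ 3 * m) := by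
    have e : m ^ 2 * (m * t ^ 3) = (m * t) ^ 3 := by ring
    rw [e]
    nlinarith [mul_le_mul_of_nonneg_left (h3.trans (mul_le_mul_of_nonneg_left h4 (sq_nonneg m))) (by norm_num : (0 : ℝ) ≤ 4)]
  exact le_of_mul_le_mul_left key (by positivity)

/-- ★★ **averaging a pointwise identification** (window / finsum form over a finite set of sites, `nK I = #I`). [this file, g42] -/
theorem nK_mul_pow_three_le_of_pointwise {I : Set E3} (hI : I.Finite) {t ζ : ℝ} (ht : 0 ≤ t) (hζ : 0 ≤ ζ) {a σ τ : E3 → ℝ}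
    (ha : ∀ x ∈ I, 0 ≤ a x) (hσ : ∀ x ∈ I, 0 ≤ σ x) (hτ0 : ∀ x ∈ I, 0 ≤ τ x)
    (hpt : ∀ x ∈ I, t ≤ a x + 3 * (τ x + σ x)) (hτ : ∑ᶠ x ∈ I, τ x ^ 2 ≤ ζ ^ 2 * nK I) :
    nK I * t ^ 3 ≤ 16 * ∑ᶠ x ∈ I, a x ^ 3 + 432 * ∑ᶠ x ∈ I, σ x ^ 3 + 108 * ζ ^ 3 * nK I := by
  have hmem : ∀ x, x ∈ hI.toFinset ↔ x ∈ I := fun x => hI.mem_toFinset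
  unfold nK at hτ ⊢
  rw [finsum_mem_eq_finite_toFinset_sum _ hI, Set.ncard_eq_toFinset_card _ hI] at hτ
  rw [finsum_mem_eq_finite_toFinset_sum _ hI, finsum_mem_eq_finite_toFinset_sum _ hI, Set.ncard_eq_toFinset_card _ hI]
  exact card_mul_pow_three_le_of_pointwise hI.toFinset ht hζ (fun x hx => ha x ((hmem x).1 hx)) (fun x hx => hσ x ((hmem x).1 hx))
    (fun x hx => hτ0 x ((hmem x).1 hx)) (fun x hx => hpt x ((hmem x).1 hx)) hτ

/-! ### XXI.3  Pointwise identification against the identity -/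

/-- ★ **pointwise identification against the identity**: if the IDENTITY fits the displacements of the `3aHi/2`-neighbours of a clean window site `x`
up to `t` (`dist (p − x) (Ψ p − Ψ x) ≤ t`, which is registration consistency), then `tilt (Q x) ≤ 3·(t + σ x)` — part TS's identification lemma with
`G := 1`. [this file, g42] -/
theorem tilt_le_of_fit_id_of_good {aHi : ℝ} {S : Set E3} {R : ℝ} {Ψ : E3 → E3} {Q : E3 → (E3 ≃ₗᵢ[ℝ] E3)} {σ : E3 → ℝ}
    (hd : IsTiltStrainData S R Ψ Q σ) {x : E3} (hx : x ∈ atomsIn (μS S) 0 R) (hgood : IsTwoShellGoodSet (1 / 16) (9 / 10) aHi S x)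
    (haHi : 3 / 2 * aHi ≤ 4) {t : ℝ} (ht : 0 ≤ t) (hfit : ∀ p ∈ S, dist p x ≤ 3 / 2 * aHi → dist (p - x) (Ψ p - Ψ x) ≤ t) :
    tilt (Q x) ≤ 3 * (t + σ x) := by
  have hs0 : 0 ≤ 3 * (t + σ x) := by
    obtain ⟨-, hσ0, -⟩ := hd
    linarith [hσ0 x]
  refine ContinuousLinearMap.opNorm_le_bound _ hs0 fun u => ?_
  have h := norm_linear_sub_rot_le_of_good hd hx hgood haHi LinearMap.id ht
    (fun p hp hpx => by simpa [dist_eq_norm] using hfit p hp hpx) u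
  have h' : ‖u - (Q x) u‖ ≤ 3 * (t + σ x) * ‖u‖ := by simpa using h
  calc ‖(((Q x).toContinuousLinearEquiv : E3 →L[ℝ] E3) - ContinuousLinearMap.id ℝ E3) u‖ = ‖(Q x) u - u‖ := by simp
    _ = ‖u - (Q x) u‖ := norm_sub_rev _ _
    _ ≤ 3 * (t + σ x) * ‖u‖ := h'

/-- ★ **pointwise identification from registration data** (the sites and data of (K)): on an `aHi`-door set (`3aHi/2 ≤ 4`), for tilt–strain data of
`Ψ` on `win R` and registration data `IsRegistered κ 4 D S (win D) H Ψ τ` at a scale `D` containing the frame of the window site `x`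
(`‖x‖ + 3aHi/2 ≤ D`): `tilt (Q x) ≤ 3·(τ x + σ x)`.  Uses of `IsRegistered` ONLY clause (i) (consistency on `4`-bonds) and `τ ≥ 0` — no `EnvClose`,
no position level. [this file, g42] -/
theorem tilt_le_of_registered_of_doorP {aHi δ : ℝ} {S : Set E3} (hS : IsDoorSetP aHi δ S) (haHi : 3 / 2 * aHi ≤ 4) {R : ℝ} {Ψ : E3 → E3}
    {Q : E3 → (E3 ≃ₗᵢ[ℝ] E3)} {σ : E3 → ℝ} (hd : IsTiltStrainData S R Ψ Q σ) {κ D : ℝ} {H : Set E3} {τ : E3 → ℝ}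
    (hreg : IsRegistered κ 4 D S (atomsIn (μS S) 0 D) H Ψ τ) {x : E3} (hx : x ∈ atomsIn (μS S) 0 R) (hxD : ‖x‖ + 3 / 2 * aHi ≤ D) :
    tilt (Q x) ≤ 3 * (τ x + σ x) := by
  have hxS : x ∈ S := (mem_atomsIn_iff.1 hx).1
  have hgood : IsTwoShellGoodSet (1 / 16) (9 / 10) aHi S x := (isCleanP_μS_iff S).1 hS.2.2.1 x hxS
  have haHi0 : 0 < aHi := by
    obtain ⟨a, ha9, haHi', -⟩ := hgood
    linarith
  have hxD' : x ∈ atomsIn (μS S) 0 D := mem_atomsIn_iff.2 ⟨hxS, by linarith⟩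
  obtain ⟨-, -, hτE, hcons, -, -⟩ := hreg
  refine tilt_le_of_fit_id_of_good hd hx hgood haHi (hτE x hxD').1 fun p hp hpx => ?_
  have hpD : p ∈ atomsIn (μS S) 0 D := by
    refine mem_atomsIn_iff.2 ⟨hp, ?_⟩
    have h1 : ‖p‖ ≤ ‖p - x‖ + ‖x‖ := norm_le_norm_sub_add p x
    rw [← dist_eq_norm] at h1
    linarith
  exact hcons x hxD' p hpD (by linarith)

/-! ### XXI.4  K_ID assembled: the mean-rotation identification -/

/-- ★★ **K_ID — THE MEAN-ROTATION IDENTIFICATION (PROVED)**.  On an `aHi`-door set (`δ > 0`, `3aHi/2 ≤ 4`), let `(Q, σ)` be tilt–strain data of `Ψ` on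
`win R`, `τ` registration data of `Ψ` at scale `D` (`IsRegistered κ 4 D S (win D) H Ψ τ`), `I ⊆ win R` a set of sites whose frames lie in `win D`
(`‖x‖ + 3aHi/2 ≤ D`) on which the mean square of `τ` is `≤ ζ²`.  Then for EVERY continuous linear map `Q̄`:
`nK I · ‖Q̄ − 1‖³ ≤ 16·Σ_I ‖Q x − Q̄‖³ + 432·Σ_I σ³ + 108·ζ³·nK I`.
In (K): `D := R`, `I := win (R − 3aHi/2)` (the sites whose frames lie in `win R`), `ζ² := Cg·η·nK(win R)/nK I = K_d·Cg·η` with `K_d` the window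
density ratio (bounded for `R ≥ R₁(aHi, δ)`, `→ 1`) — identification remainder `108·(K_d·Cg·η)^{3/2}` per site, `o(η)`.
ENERGY-FREE; no chart, no Poincaré inequality, no position budget. [this file, g42] -/
theorem meanRotation_identification {aHi δ : ℝ} (hδ : 0 < δ) {S : Set E3} (hS : IsDoorSetP aHi δ S) (haHi : 3 / 2 * aHi ≤ 4) {R : ℝ}
    {Ψ : E3 → E3} {Q : E3 → (E3 ≃ₗᵢ[ℝ] E3)} {σ : E3 → ℝ} (hd : IsTiltStrainData S R Ψ Q σ) {κ D : ℝ} {H : Set E3} {τ : E3 → ℝ}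
    (hreg : IsRegistered κ 4 D S (atomsIn (μS S) 0 D) H Ψ τ) {I : Set E3} (hIR : I ⊆ atomsIn (μS S) 0 R)
    (hID : ∀ x ∈ I, ‖x‖ + 3 / 2 * aHi ≤ D) (Qbar : E3 →L[ℝ] E3) {ζ : ℝ} (hζ : 0 ≤ ζ) (hτ : ∑ᶠ x ∈ I, τ x ^ 2 ≤ ζ ^ 2 * nK I) :
    nK I * ‖Qbar - ContinuousLinearMap.id ℝ E3‖ ^ 3 ≤
      16 * ∑ᶠ x ∈ I, ‖((Q x).toContinuousLinearEquiv : E3 →L[ℝ] E3) - Qbar‖ ^ 3 + 432 * ∑ᶠ x ∈ I, σ x ^ 3 + 108 * ζ ^ 3 * nK I := by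
  have hI : I.Finite := (finite_atomsIn hδ hS.2.1 R).subset hIR
  obtain ⟨-, hσ0, -⟩ := id hd
  have hτ0 : ∀ x ∈ I, 0 ≤ τ x := by
    obtain ⟨-, -, hτE, -, -, -⟩ := hreg
    intro x hx
    have hxS : x ∈ S := (mem_atomsIn_iff.1 (hIR hx)).1
    have hgood : IsTwoShellGoodSet (1 / 16) (9 / 10) aHi S x := (isCleanP_μS_iff S).1 hS.2.2.1 x hxS
    have haHi0 : 0 < aHi := by
      obtain ⟨a, ha9, haHi', -⟩ := hgood
      linarith
    exact (hτE x (mem_atomsIn_iff.2 ⟨hxS, by linarith [hID x hx]⟩)).1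
  refine nK_mul_pow_three_le_of_pointwise hI (norm_nonneg _) hζ (fun x _ => norm_nonneg _) (fun x _ => hσ0 x) hτ0 (fun x hx => ?_) hτ
  have hpt := tilt_le_of_registered_of_doorP hS haHi hd hreg (hIR hx) (hID x hx)
  have htri : ‖Qbar - ContinuousLinearMap.id ℝ E3‖ ≤
      ‖Qbar - ((Q x).toContinuousLinearEquiv : E3 →L[ℝ] E3)‖ + tilt (Q x) := norm_sub_le_norm_sub_add_norm_sub _ _ _
  have e : ‖Qbar - ((Q x).toContinuousLinearEquiv : E3 →L[ℝ] E3)‖ = ‖((Q x).toContinuousLinearEquiv : E3 →L[ℝ] E3) - Qbar‖ :=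
    norm_sub_rev _ _
  rw [e] at htri
  linarith

/-! ### XXI.5  The tilt split and the product form for the (K) seam -/

/-- **tilt split**: `Σ_W tilt (Q x)³ ≤ 4·Σ_W ‖Q x − Q̄‖³ + 4·nK W·‖Q̄ − 1‖³` for any finite `W` and any `Q̄`. [this file, g42] -/
theorem finsum_tilt_pow_three_le {W : Set E3} (hW : W.Finite) (Q : E3 → (E3 ≃ₗᵢ[ℝ] E3)) (Qbar : E3 →L[ℝ] E3) :
    ∑ᶠ x ∈ W, tilt (Q x) ^ 3 ≤
      4 * ∑ᶠ x ∈ W, ‖((Q x).toContinuousLinearEquiv : E3 →L[ℝ] E3) - Qbar‖ ^ 3 + 4 * nK W * ‖Qbar - ContinuousLinearMap.id ℝ E3‖ ^ 3 := by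
  unfold nK
  rw [finsum_mem_eq_finite_toFinset_sum _ hW, finsum_mem_eq_finite_toFinset_sum _ hW, Set.ncard_eq_toFinset_card _ hW]
  set t : ℝ := ‖Qbar - ContinuousLinearMap.id ℝ E3‖ with htdef
  have hpt : ∀ x ∈ hW.toFinset, tilt (Q x) ^ 3 ≤ 4 * ‖((Q x).toContinuousLinearEquiv : E3 →L[ℝ] E3) - Qbar‖ ^ 3 + 4 * t ^ 3 := by
    intro x _
    have htri : tilt (Q x) ≤ ‖((Q x).toContinuousLinearEquiv : E3 →L[ℝ] E3) - Qbar‖ + t := norm_sub_le_norm_sub_add_norm_sub _ _ _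
    have h1 : tilt (Q x) ^ 3 ≤ (‖((Q x).toContinuousLinearEquiv : E3 →L[ℝ] E3) - Qbar‖ + t) ^ 3 := pow_le_pow_left₀ (tilt_nonneg _) htri 3
    have h2 := add_pow_three_le_four_mul (norm_nonneg (((Q x).toContinuousLinearEquiv : E3 →L[ℝ] E3) - Qbar)) (norm_nonneg _ : 0 ≤ t)
    linarith
  refine (Finset.sum_le_sum hpt).trans (le_of_eq ?_)
  rw [Finset.sum_add_distrib, Finset.sum_const, nsmul_eq_mul, ← Finset.mul_sum]
  ring

/-- ★★ **product form for the (K) seam**: with `W := win R`, `I ⊆ W` as in `meanRotation_identification` and any `Q̄`,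
`nK I · Σ_W tilt³ ≤ nK I · 4·Σ_W ‖Q x − Q̄‖³ + nK W · 4·(16·Σ_I ‖Q x − Q̄‖³ + 432·Σ_I σ³ + 108·ζ³·nK I)`.
The (K) seam then needs only (K_F) `Σ_W ‖Q x − Q̄‖³ ≤ C_F·Σ σ³` for some `Q̄` and (K_dens) `nK W ≤ K_d·nK I`. [this file, g42] -/
theorem nK_mul_finsum_tilt_pow_three_le {aHi δ : ℝ} (hδ : 0 < δ) {S : Set E3} (hS : IsDoorSetP aHi δ S) (haHi : 3 / 2 * aHi ≤ 4) {R : ℝ}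
    {Ψ : E3 → E3} {Q : E3 → (E3 ≃ₗᵢ[ℝ] E3)} {σ : E3 → ℝ} (hd : IsTiltStrainData S R Ψ Q σ) {κ D : ℝ} {H : Set E3} {τ : E3 → ℝ}
    (hreg : IsRegistered κ 4 D S (atomsIn (μS S) 0 D) H Ψ τ) {I : Set E3} (hIR : I ⊆ atomsIn (μS S) 0 R)
    (hID : ∀ x ∈ I, ‖x‖ + 3 / 2 * aHi ≤ D) (Qbar : E3 →L[ℝ] E3) {ζ : ℝ} (hζ : 0 ≤ ζ) (hτ : ∑ᶠ x ∈ I, τ x ^ 2 ≤ ζ ^ 2 * nK I) :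
    nK I * ∑ᶠ x ∈ atomsIn (μS S) 0 R, tilt (Q x) ^ 3 ≤
      nK I * (4 * ∑ᶠ x ∈ atomsIn (μS S) 0 R, ‖((Q x).toContinuousLinearEquiv : E3 →L[ℝ] E3) - Qbar‖ ^ 3) +
        nK (atomsIn (μS S) 0 R) *
          (4 * (16 * ∑ᶠ x ∈ I, ‖((Q x).toContinuousLinearEquiv : E3 →L[ℝ] E3) - Qbar‖ ^ 3 + 432 * ∑ᶠ x ∈ I, σ x ^ 3 + 108 * ζ ^ 3 * nK I)) := by
  have hW : (atomsIn (μS S) 0 R).Finite := finite_atomsIn hδ hS.2.1 R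
  have hsplit := finsum_tilt_pow_three_le hW Q Qbar
  have hid := meanRotation_identification hδ hS haHi hd hreg hIR hID Qbar hζ hτ
  have hI0 : 0 ≤ nK I := nK_nonneg I
  have hW0 : 0 ≤ nK (atomsIn (μS S) 0 R) := nK_nonneg _
  have h1 := mul_le_mul_of_nonneg_left hsplit hI0
  have h2 := mul_le_mul_of_nonneg_left hid hW0
  nlinarith [h1, h2]

end Summit.AtomisticToContinuum.Crystallization.Theorems.ChartedZeroExcessLayeredLatticeLiouville

end
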